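/-
COR-CM (cell pub-hodgecm2, stage 2 of the Hodge ladder) — TRANSPOSITION SURGE, item (vi) pinning record, binder `hComp`
(REACH half), TEAM hComp row U1⁺′ of `HOME/pinning/HCOMP-TABLE.md` (lead 2026-08-21 19:43Z): `pieces_of_record` — the clause
(F2c) `pieces` of Deligne's canonical-model record DERIVED from its clauses (F1) smooth/projective, (F2a) `pts`, (F2b) `hol`
(RESERVE B′: filed only if x1's v5 p300664 is refused, or on a STRONGER-THAN-CONSUMED finding on the v5 field, or after
`Item6PinReachClosed`).  Seat prover-pub-hodgecm2-hcomp-compare-2-0 (`hcomp-compare-2`; path under the pub-hodgecm2 lead's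
blanket pre-ACK for tabled `Transposition/HComp/<Name>.lean` files, one writer).  THEOREMS ONLY: no definition, no instance,
no named fact, nothing asserted; every landed file untouched.  FRAMING: HC_CM is NOT proved; nothing here discharges
`hComp`/`hUnif`.
-/
import Summits.HodgeConjecture.CorCM.B01.Transposition.HComp.ComponentBallDatumHol
import Literature.AlgebraicGeometry.ShimuraVarieties.ShimuraSetModelComponentsCoproduct
import Literature.AlgebraicGeometry.ShimuraVarieties.UnitaryShimuraCanonicalModel
import Literature.AlgebraicGeometry.Motives.BaseChangeProofs
import Literature.AlgebraicGeometry.Motives.BaseChangePointsProofs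
import Literature.AlgebraicGeometry.HodgeTheory.HodgeGenericQbarDescentProofs
import HarnessLib

/-!
# The pieces of the complex fibre of Deligne's canonical model, DERIVED (clause (F2c) from (F1), (F2a), (F2b))

For `R : UnitaryCanonicalModel.Record L H τ T hT K` ([Deligne 1979] 2.2.5 read as the tree's record, v4 = p300116:
`M` smooth projective over `L`, `pts : M(ℂ)_{along τ} ≃ₜ Sh_K(ℂ)`, `hol`), with `H` hermitian anisotropic of signature `(2,1)`
at `τ` and definite elsewhere, `K` compact open and every conjugate arithmetic level `U(H)(L⁺) ∩ gKg⁻¹` torsion-free (the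
hypotheses of `exists_recordSystem`), the complex fibre `M_τ = M ⊗_{L,τ} ℂ` is the finite COPRODUCT (colimit cofan in
`SchemeOver ℂ`), indexed by `Ξ_K = U(H)(L⁺) \ U(H)(𝔸_{L⁺,f}) / K` through representatives `g_q`, of pieces `X_q` each carrying a
`UnitaryBallUniformisationDatum 2` with complex Gram matrix `H^τ`, group `τ(U(H)(L⁺) ∩ g_qKg_q⁻¹)` (NATURAL levels) and
uniformisation `z ↦ [z, g_qK]` — EXACTLY the shape of the field `RecordSystem.pieces` of x1's v5 (so a consumer of the
v5 field can read `pieces_of_record` instead, term for term).  Assembly of tree theorems: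

* (F1) under base change: `M_τ` smooth of relative dimension `2` (`HodgeTheory.smoothOfRelativeDimension_baseChangeHom_hom`,
  Liu 2002 Prop. 4.3.38) and projective (`Motives.IsProjectiveOver.baseChange_obj`, Liu 2002 Prop. 3.1.23);
* (F2a) moved to `M_τ(ℂ)`: `e := pts ∘ (AlgPoints.baseChangeEquiv τ M)⁻¹`, a homeomorphism (`AlgPoints.continuous_baseChangeEquiv`,
  `…_symm`; Conrad 2012 Prop. 2.1/3.1);
* (T2) component extraction WITH the scheme-level colimit: `Deligne1979.exists_components_homeomorph_ballQuotient_isColimit`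
  (mc-binder-2; [Deligne 1979] 2.1.2–2.1.3, Milne Lemma 5.13, Görtz–Wedhorn I Ex. 3.16);
* per piece: the ball datum `HComp.exists_pieceBallDatum` (topological half `exists_pieceUnif` + holomorphy of `hol` moved
  along the open immersion + algebraic half `PicardCode.ofHermitian`), with congruence of `U(H)(L⁺) ∩ gKg⁻¹` from
  `UnitaryGroup.isCongruenceSubgroup_arithmeticLevel_of_isOpen` (`isCompact_map_conj`, `isOpen_map_conj`) and torsion-freeness
  = the record hypothesis `htf`.

Main results (namespace `Summit.HodgeConjecture.CorCM.HComp`): `exists_pieces_of_components` (from any component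
presentation of any model `X` — the (T2) package as INPUT), `Record.exists_pieces` (one level), `RecordSystem.exists_pieces`
(every small level; the v5 field `pieces` verbatim).  0 hypothesis binders of Prop-valued named facts (T5: n/a).

References: P. Deligne, *Variétés de Shimura*, Proc. Symp. Pure Math. 33.2 (1979), 2.1.2–2.1.3, 2.2.5; J. S. Milne,
*Introduction to Shimura varieties* (2005), Lemma 5.13; Q. Liu, *Algebraic Geometry and Arithmetic Curves* (2002), Prop. 3.1.23,
Prop. 4.3.38; B. Conrad, Enseign. Math. 58 (2012), Prop. 2.1, 3.1; N. Bergeron, J. Millson, C. Moeglin, Acta Math. 216 (2016),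
Introduction §1.1, Part 2 §§1.1–1.4.
-/

set_option autoImplicit false

noncomputable section

open scoped Matrix Topology ComplexOrder
open Set Function MulAction Matrix NumberField CategoryTheory CategoryTheory.Limits AlgebraicGeometry Opposite
open Literature.Geometry.ComplexHyperbolic
open Literature.Geometry.ComplexHyperbolic.BallModel (U21 Ball proj lift mat x₀)
open Literature.NumberTheory.Automorphic
open Literature.NumberTheory.Automorphic.UnitaryGroup
open Literature.NumberTheory.Automorphic.ShimuraDissection (CosetSpace)
open Literature.AlgebraicGeometry.ShimuraVarieties (negCone hermForm UnitaryBallUniformisationDatum IsCongruenceSubgroup)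
open Literature.AlgebraicGeometry.ShimuraVarieties.UnitaryCanonicalModel (Record RecordSystem)
open Literature.AlgebraicGeometry.Motives (SchemeOver ComplexPoints AlgPoints IsSmoothProjective IsProjectiveOver baseChangeHom)
open Literature.NumberTheory.Automorphic.Liu2021.AppendixC (C5.OpenCompactSubgroup C5.SmallLevel)

namespace Summit.HodgeConjecture.CorCM.HComp

variable (L : Type) [Field L] [NumberField L] [IsCMField L] (H : Matrix (Fin 3) (Fin 3) L)
  (τ : L →+* ℂ) (T : GL (Fin 3) ℂ) (hT : formCongr (starRingEnd ℂ) T (H.map τ) = BallModel.J)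
  (K : Subgroup (finAdelic (↥(maximalRealSubfield L)) L (IsCMField.complexConj L) 3 H))

/-! ## 0. Conjugate levels are compact open (the inputs of `isCongruenceSubgroup_arithmeticLevel_of_isOpen` at `gKg⁻¹`) -/

section ConjLevel

variable {F E : Type} [Field F] [Field E] [NumberField E] [Algebra F E] {c : E ≃ₐ[F] E} {N : ℕ}
  {J : Matrix (Fin N) (Fin N) E}

/-- A conjugate `gKg⁻¹` of an open level `K ≤ U(J)(𝔸_{F,f})` is open (conjugation is a homeomorphism of the topological group;
the tree's private twin lives in `UnitaryGroupConjugateLevelTorsionFree`). [folklore] -/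
theorem isOpen_coe_map_conj {K : Subgroup (finAdelic F E c N J)} (hK : IsOpen (K : Set (finAdelic F E c N J)))
    (g : finAdelic F E c N J) :
    IsOpen ((K.map (MulAut.conj g).toMonoidHom : Subgroup (finAdelic F E c N J)) : Set (finAdelic F E c N J)) := by
  rw [Subgroup.coe_map]
  have : (⇑(MulAut.conj g).toMonoidHom : finAdelic F E c N J → finAdelic F E c N J) =
      (Homeomorph.mulLeft g).trans (Homeomorph.mulRight g⁻¹) := by
    ext x
    rfl
  rw [this]
  exact (Homeomorph.isOpenMap _) _ hK

/-- A conjugate `gKg⁻¹` of a compact level `K ≤ U(J)(𝔸_{F,f})` is compact. [folklore] -/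
theorem isCompact_coe_map_conj {K : Subgroup (finAdelic F E c N J)} (hK : IsCompact (K : Set (finAdelic F E c N J)))
    (g : finAdelic F E c N J) :
    IsCompact ((K.map (MulAut.conj g).toMonoidHom : Subgroup (finAdelic F E c N J)) : Set (finAdelic F E c N J)) := by
  rw [Subgroup.coe_map]
  have : (⇑(MulAut.conj g).toMonoidHom : finAdelic F E c N J → finAdelic F E c N J) =
      (Homeomorph.mulLeft g).trans (Homeomorph.mulRight g⁻¹) := by
    ext x
    rfl
  rw [this]
  exact hK.image (Homeomorph.continuous _)

/-- Torsion-freeness of the conjugate arithmetic levels DESCENDS from `K₀` to every `K ≤ K₀`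
(`U(H)(L⁺) ∩ gKg⁻¹ ≤ U(H)(L⁺) ∩ gK₀g⁻¹`, tree `UnitaryGroup.arithmeticLevel_mono`) — the small-level hypothesis of
`UnitaryCanonicalModel.exists_recordSystem` read at the levels of the system. [folklore] -/
theorem torsionFree_arithmeticLevel_conj_of_le {K₀ K : Subgroup (finAdelic F E c N J)} (hK : K ≤ K₀)
    (htf : ∀ g : finAdelic F E c N J, ∀ γ ∈ arithmeticLevel F E c N J (K₀.map (MulAut.conj g).toMonoidHom),
      IsOfFinOrder γ → γ = 1)
    (g : finAdelic F E c N J) :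
    ∀ γ ∈ arithmeticLevel F E c N J (K.map (MulAut.conj g).toMonoidHom), IsOfFinOrder γ → γ = 1 :=
  fun γ hγ hfin => htf g γ (arithmeticLevel_mono (Subgroup.map_mono hK) hγ) hfin

end ConjLevel

/-! ## 1. From a component presentation of a complex model to the pieces shape -/

/-- **Pieces from components.**  Let `X` be a complex scheme with `u_a : ℂ³ → X(ℂ)` (`a ∈ U(H)(𝔸_{L⁺,f})`) as in the record's
clause `hol` relative to points `P_{z,a} ∈ X(ℂ)` (`u_a(T·(z,1)) = P_{z,a}`, homogeneous, holomorphic in the algebraic coordinates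
of `X`), and let `(E_q, ι_q, φ_q)_{q ∈ Ξ_K}` be a component presentation of `X` through representatives `g_q`: `E_q` smooth
projective surfaces, `ι_q` open immersions forming a colimit cofan, `φ_q : E_q(ℂ) ≃ₜ Δ(U(H)(L⁺) ∩ g_qKg_q⁻¹)\𝔹²` with
`ι_q(φ_q⁻¹[z]) = P_{z,g_q}` (the output of `Deligne1979.exists_components_homeomorph_ballQuotient_isColimit`).  Then — for `H`
hermitian anisotropic, definite off `τ`, `K` compact open with torsion-free conjugate arithmetic levels — each `E_q` carries a
`UnitaryBallUniformisationDatum 2` with `Hℂ = H^τ`, group `τ(U(H)(L⁺) ∩ g_qKg_q⁻¹)` and `ι_q(unif(T·(z,1))) = P_{z,g_q}`: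
the v5 `pieces` shape with apex `X`. [cite: Deligne1979ShimuraVarieties, §2.1.2] [cite: Milne2005ShimuraVarieties, Lemma 5.13]
[cite: BergeronMillsonMoeglin2016Balls, Introduction §1.1 and Part 2 §§1.1–1.4] -/
theorem exists_pieces_of_components
    (hH : ∀ i j, cmConjRingHom L (H i j) = H j i)
    (hanis : ∀ v : Fin 3 → L, hermForm (cmConjRingHom L) H v v = 0 → v = 0)
    (hpos : ∀ τ' : L →+* ℂ, InfinitePlace.mk τ' ≠ InfinitePlace.mk τ → (H.map τ').PosDef)
    (hKc : IsCompact (K : Set (finAdelic (↥(maximalRealSubfield L)) L (IsCMField.complexConj L) 3 H)))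
    (hKo : IsOpen (K : Set (finAdelic (↥(maximalRealSubfield L)) L (IsCMField.complexConj L) 3 H)))
    (htf : ∀ g : finAdelic (↥(maximalRealSubfield L)) L (IsCMField.complexConj L) 3 H,
      ∀ γ ∈ arithmeticLevel (↥(maximalRealSubfield L)) L (IsCMField.complexConj L) 3 H
        (K.map (MulAut.conj g).toMonoidHom), IsOfFinOrder γ → γ = 1)
    {X : SchemeOver ℂ}
    (P : Ball → finAdelic (↥(maximalRealSubfield L)) L (IsCMField.complexConj L) 3 H → ComplexPoints X)
    (hol : ∀ a : finAdelic (↥(maximalRealSubfield L)) L (IsCMField.complexConj L) 3 H,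
      ∃ u : (Fin 3 → ℂ) → ComplexPoints X,
        (∀ x : Ball, u ((T : Matrix (Fin 3) (Fin 3) ℂ) *ᵥ lift x) = P x a) ∧
        (∀ v ∈ negCone (H.map τ), ∀ c : ℂ, c ≠ 0 → u (c • v) = u v) ∧
        ∀ (U : X.left.affineOpens) (f : X.left.presheaf.obj (op (U : X.left.Opens))),
          DifferentiableOn ℂ (fun v ↦ AlgPoints.evalOrZero (U : X.left.Opens) f (u v))
            (negCone (H.map τ) ∩ u ⁻¹' {Q | Q.pt ∈ (U : X.left.Opens)}))
    (g : orbitRel.Quotient (rational (↥(maximalRealSubfield L)) L (IsCMField.complexConj L) 3 H)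
          (CosetSpace (rationalToFinAdelic (↥(maximalRealSubfield L)) L (IsCMField.complexConj L) 3 H) K) →
        finAdelic (↥(maximalRealSubfield L)) L (IsCMField.complexConj L) 3 H)
    (E : orbitRel.Quotient (rational (↥(maximalRealSubfield L)) L (IsCMField.complexConj L) 3 H)
          (CosetSpace (rationalToFinAdelic (↥(maximalRealSubfield L)) L (IsCMField.complexConj L) 3 H) K) →
        SchemeOver ℂ)
    (ι : ∀ q, E q ⟶ X)
    (φ : ∀ q, ComplexPoints (E q) ≃ₜ
      orbitRel.Quotient
        (archImageU21 L H τ T hT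
          (arithmeticLevel (↥(maximalRealSubfield L)) L (IsCMField.complexConj L) 3 H
            (K.map (MulAut.conj (g q)).toMonoidHom)))
        Ball)
    (hE : ∀ q, IsSmoothProjective 2 (E q)) (hopen : ∀ q, IsOpenImmersion (ι q).left)
    (hφ : ∀ q (z : Ball), AlgPoints.map (L := ℂ) (ι q) ((φ q).symm (Quotient.mk'' z)) = P z (g q))
    (hcol : IsColimit (Cofan.mk X ι)) :
    ∃ (X' : orbitRel.Quotient (rational (↥(maximalRealSubfield L)) L (IsCMField.complexConj L) 3 H)
          (CosetSpace (rationalToFinAdelic (↥(maximalRealSubfield L)) L (IsCMField.complexConj L) 3 H) K) →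
        SchemeOver ℂ)
      (ι' : ∀ q, X' q ⟶ X)
      (_ : IsColimit (Cofan.mk X ι'))
      (B : ∀ q, UnitaryBallUniformisationDatum 2 (X' q)),
      ∀ q, (B q).Hℂ = H.map τ ∧
        (B q).Γ.map (Matrix.GeneralLinearGroup.map ((B q).τ₁ : ↥(B q).E →+* ℂ)) =
          (arithmeticLevel (↥(maximalRealSubfield L)) L (IsCMField.complexConj L) 3 H
            (K.map (MulAut.conj (g q)).toMonoidHom)).map (Matrix.GeneralLinearGroup.map τ) ∧
        ∀ x : Ball, AlgPoints.map (L := ℂ) (ι' q) ((B q).unif ((T : Matrix (Fin 3) (Fin 3) ℂ) *ᵥ lift x)) = P x (g q) := by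
  classical
  -- per piece: the ball datum
  have hB : ∀ q, ∃ B : UnitaryBallUniformisationDatum 2 (E q),
      B.E = τ.fieldRange ∧ B.Hℂ = H.map τ ∧
        B.Γ.map (Matrix.GeneralLinearGroup.map (B.τ₁ : B.E →+* ℂ)) =
          (arithmeticLevel (↥(maximalRealSubfield L)) L (IsCMField.complexConj L) 3 H
            (K.map (MulAut.conj (g q)).toMonoidHom)).map (Matrix.GeneralLinearGroup.map τ) ∧
        ∀ z : Ball, B.unif ((T : Matrix (Fin 3) (Fin 3) ℂ) *ᵥ lift z) = (φ q).symm (Quotient.mk'' z) := by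
    intro q
    haveI := hopen q
    obtain ⟨u, hu1, hu2, hu3⟩ := hol (g q)
    -- the natural level `U(H)(L⁺) ∩ g_qKg_q⁻¹` is a congruence subgroup (compact open conjugate) and torsion-free
    have hcong : IsCongruenceSubgroup (cmConjRingHom L) H
        (arithmeticLevel (↥(maximalRealSubfield L)) L (IsCMField.complexConj L) 3 H
          (K.map (MulAut.conj (g q)).toMonoidHom)) :=
      isCongruenceSubgroup_arithmeticLevel_of_isOpen (isCompact_coe_map_conj hKc (g q)) (isOpen_coe_map_conj hKo (g q))
    exact exists_pieceBallDatum L H τ T hT hH hanis hpos hcong (htf (g q)) (ι q) (hE q) (φ q) u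
      (fun z => by rw [hu1 z, hφ q z]) hu2 hu3
  choose B hB using hB
  exact ⟨E, ι, hcol, B, fun q => ⟨(hB q).2.1, (hB q).2.2.1, fun x => by rw [(hB q).2.2.2 x, hφ q x]⟩⟩

/-! ## 2. The pieces of the complex fibre of the record (one level) -/

/-- **(F2c) `pieces` DERIVED, one level.**  For Deligne's canonical-model record `R : Record L H τ T hT K` (v4: (F1) smooth
projective, (F2a) `pts`, (F2b) `hol`), with `H` hermitian anisotropic definite off `τ` and `K` compact open with torsion-free
conjugate arithmetic levels: the complex fibre `M_τ = (baseChangeHom τ).obj R.M` is a colimit cofan, indexed by `Ξ_K` through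
representatives `g_q`, of pieces `X_q` each carrying a `UnitaryBallUniformisationDatum 2` with `Hℂ = H^τ`, group
`τ(U(H)(L⁺) ∩ g_qKg_q⁻¹)` and `ι_q(unif(T·(z,1))) = baseChangeEquiv τ M (pts⁻¹ [z, g_qK])` — the v5 field `Record.pieces`
VERBATIM, as a theorem over the v4 fields.  Inputs: (F1) under base change (smooth: `HodgeTheory.smoothOfRelativeDimension_baseChangeHom_hom`;
projective: `IsProjectiveOver.baseChange_obj`), (F2a) through `AlgPoints.baseChangeEquiv τ` (a homeomorphism:
`AlgPoints.continuous_baseChangeEquiv(_symm)`), representatives by `CosetSpace.pt_surjective`, (T2) with colimit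
`Deligne1979.exists_components_homeomorph_ballQuotient_isColimit`, and §1.
[cite: Deligne1979ShimuraVarieties, §2.1.2–2.1.3 and 2.2.5] [cite: Milne2005ShimuraVarieties, Lemma 5.13]
[cite: Liu2002, Prop. 3.1.23 and Prop. 4.3.38] [cite: ConradAdelicPoints2012, Prop. 2.1 and Prop. 3.1] -/
theorem Record.exists_pieces
    (hH : ∀ i j, cmConjRingHom L (H i j) = H j i)
    (hanis : ∀ v : Fin 3 → L, hermForm (cmConjRingHom L) H v v = 0 → v = 0)
    (hpos : ∀ τ' : L →+* ℂ, InfinitePlace.mk τ' ≠ InfinitePlace.mk τ → (H.map τ').PosDef)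
    (hKc : IsCompact (K : Set (finAdelic (↥(maximalRealSubfield L)) L (IsCMField.complexConj L) 3 H)))
    (hKo : IsOpen (K : Set (finAdelic (↥(maximalRealSubfield L)) L (IsCMField.complexConj L) 3 H)))
    (htf : ∀ g : finAdelic (↥(maximalRealSubfield L)) L (IsCMField.complexConj L) 3 H,
      ∀ γ ∈ arithmeticLevel (↥(maximalRealSubfield L)) L (IsCMField.complexConj L) 3 H
        (K.map (MulAut.conj g).toMonoidHom), IsOfFinOrder γ → γ = 1)
    (R : Record L H τ T hT K) :
    letI : Algebra L ℂ := τ.toAlgebra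
    ∃ (g : orbitRel.Quotient (rational (↥(maximalRealSubfield L)) L (IsCMField.complexConj L) 3 H)
          (CosetSpace (rationalToFinAdelic (↥(maximalRealSubfield L)) L (IsCMField.complexConj L) 3 H) K) →
        finAdelic (↥(maximalRealSubfield L)) L (IsCMField.complexConj L) 3 H)
      (_ : ∀ q, Quotient.mk'' (CosetSpace.pt (rationalToFinAdelic _ L _ 3 H) K (g q)) = q)
      (X : orbitRel.Quotient (rational (↥(maximalRealSubfield L)) L (IsCMField.complexConj L) 3 H)
          (CosetSpace (rationalToFinAdelic (↥(maximalRealSubfield L)) L (IsCMField.complexConj L) 3 H) K) →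
        SchemeOver ℂ)
      (ι : ∀ q, X q ⟶ (baseChangeHom τ).obj R.M)
      (_ : IsColimit (Cofan.mk ((baseChangeHom τ).obj R.M) ι))
      (B : ∀ q, UnitaryBallUniformisationDatum 2 (X q)),
      ∀ q, (B q).Hℂ = H.map τ ∧
        (B q).Γ.map (Matrix.GeneralLinearGroup.map ((B q).τ₁ : ↥(B q).E →+* ℂ)) =
          (arithmeticLevel (↥(maximalRealSubfield L)) L (IsCMField.complexConj L) 3 H
            (K.map (MulAut.conj (g q)).toMonoidHom)).map (Matrix.GeneralLinearGroup.map τ) ∧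
        ∀ x : Ball, AlgPoints.map (ι q) ((B q).unif ((T : Matrix (Fin 3) (Fin 3) ℂ) *ᵥ BallModel.lift x)) =
          AlgPoints.baseChangeEquiv τ R.M (R.pts.symm (ShimuraSet.mk L H τ T hT K x (g q))) := by
  classical
  letI : Algebra L ℂ := τ.toAlgebra
  -- (F1) under base change: the complex fibre is a smooth projective model
  haveI hsm : SmoothOfRelativeDimension 2 ((baseChangeHom τ).obj R.M).hom := by
    haveI := R.smooth
    exact Literature.AlgebraicGeometry.HodgeTheory.smoothOfRelativeDimension_baseChangeHom_hom τ 2 R.M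
  have hpr : IsProjectiveOver ((baseChangeHom τ).obj R.M) := R.projective.baseChange_obj ℂ
  -- (F2a) moved to the complex fibre: `e⁻¹ [z, aK] = baseChangeEquiv τ M (pts⁻¹ [z, aK])`
  let b : ComplexPoints R.M ≃ₜ ComplexPoints ((baseChangeHom τ).obj R.M) :=
    Homeomorph.mk (AlgPoints.baseChangeEquiv τ R.M) (AlgPoints.continuous_baseChangeEquiv τ R.M)
      (AlgPoints.continuous_baseChangeEquiv_symm τ R.M)
  let e : ComplexPoints ((baseChangeHom τ).obj R.M) ≃ₜ ShimuraSet L H τ T hT K := b.symm.trans R.pts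
  have he : ∀ (z : Ball) (a : finAdelic (↥(maximalRealSubfield L)) L (IsCMField.complexConj L) 3 H),
      e.symm (ShimuraSet.mk L H τ T hT K z a) =
        AlgPoints.baseChangeEquiv τ R.M (R.pts.symm (ShimuraSet.mk L H τ T hT K z a)) := fun _ _ => rfl
  -- representatives of `Ξ_K`
  have hrep : ∀ q : orbitRel.Quotient (rational (↥(maximalRealSubfield L)) L (IsCMField.complexConj L) 3 H)
      (CosetSpace (rationalToFinAdelic (↥(maximalRealSubfield L)) L (IsCMField.complexConj L) 3 H) K),
      ∃ a : finAdelic (↥(maximalRealSubfield L)) L (IsCMField.complexConj L) 3 H,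
        Quotient.mk'' (CosetSpace.pt (rationalToFinAdelic _ L _ 3 H) K a) = q := by
    intro q
    induction q using Quotient.inductionOn' with
    | h p =>
      obtain ⟨a, rfl⟩ := CosetSpace.pt_surjective (rationalToFinAdelic _ L _ 3 H) K p
      exact ⟨a, rfl⟩
  choose g hg using hrep
  -- (T2) with the scheme-level colimit
  obtain ⟨E, ι, φ, hE, hopen, -, -, -, hφ, -, ⟨hcol⟩⟩ :=
    Literature.AlgebraicGeometry.ShimuraVarieties.Deligne1979.exists_components_homeomorph_ballQuotient_isColimit
      L H τ T hT K (d := 2) hpr hKo e g hg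
  -- §1 with `P z a := e⁻¹ [z, aK]`
  obtain ⟨X', ι', hcol', B, hB⟩ := exists_pieces_of_components L H τ T hT K hH hanis hpos hKc hKo htf
    (fun z a => e.symm (ShimuraSet.mk L H τ T hT K z a))
    (fun a => by
      obtain ⟨u, hu1, hu2, hu3⟩ := R.hol a
      exact ⟨u, fun x => by rw [hu1 x, he], hu2, hu3⟩)
    g E ι φ hE hopen hφ hcol
  exact ⟨g, hg, X', ι', hcol', B, fun q => ⟨(hB q).1, (hB q).2.1, fun x => by rw [(hB q).2.2 x, he]⟩⟩

/-! ## 3. The pieces at every small level of the system -/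

/-- **(F2c) `pieces` DERIVED, every small level `K ≤ K₀`** — the v5 field `RecordSystem.pieces` VERBATIM as a theorem over the
v4 system (`RecordSystem.record K` and §2). [cite: Deligne1979ShimuraVarieties, §2.1.2–2.1.4 and 2.2.5]
[cite: Milne2005ShimuraVarieties, Lemma 5.13 and Def. 12.10] -/
theorem RecordSystem.exists_pieces
    {K₀ : C5.OpenCompactSubgroup ↥(finAdelic (↥(maximalRealSubfield L)) L (IsCMField.complexConj L) 3 H)}
    (hH : ∀ i j, cmConjRingHom L (H i j) = H j i)
    (hanis : ∀ v : Fin 3 → L, hermForm (cmConjRingHom L) H v v = 0 → v = 0)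
    (hpos : ∀ τ' : L →+* ℂ, InfinitePlace.mk τ' ≠ InfinitePlace.mk τ → (H.map τ').PosDef)
    (htf : ∀ g : finAdelic (↥(maximalRealSubfield L)) L (IsCMField.complexConj L) 3 H,
      ∀ γ ∈ arithmeticLevel (↥(maximalRealSubfield L)) L (IsCMField.complexConj L) 3 H
        (K₀.1.map (MulAut.conj g).toMonoidHom), IsOfFinOrder γ → γ = 1)
    (S : RecordSystem L H τ T hT K₀) (K : C5.SmallLevel K₀) :
    letI : Algebra L ℂ := τ.toAlgebra
    ∃ (g : orbitRel.Quotient (rational (↥(maximalRealSubfield L)) L (IsCMField.complexConj L) 3 H)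
          (CosetSpace (rationalToFinAdelic (↥(maximalRealSubfield L)) L (IsCMField.complexConj L) 3 H) K.1.1) →
        finAdelic (↥(maximalRealSubfield L)) L (IsCMField.complexConj L) 3 H)
      (_ : ∀ q, Quotient.mk'' (CosetSpace.pt (rationalToFinAdelic _ L _ 3 H) K.1.1 (g q)) = q)
      (X : orbitRel.Quotient (rational (↥(maximalRealSubfield L)) L (IsCMField.complexConj L) 3 H)
          (CosetSpace (rationalToFinAdelic (↥(maximalRealSubfield L)) L (IsCMField.complexConj L) 3 H) K.1.1) →
        SchemeOver ℂ)
      (ι : ∀ q, X q ⟶ (baseChangeHom τ).obj (S.M.obj K))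
      (_ : IsColimit (Cofan.mk ((baseChangeHom τ).obj (S.M.obj K)) ι))
      (B : ∀ q, UnitaryBallUniformisationDatum 2 (X q)),
      ∀ q, (B q).Hℂ = H.map τ ∧
        (B q).Γ.map (Matrix.GeneralLinearGroup.map ((B q).τ₁ : ↥(B q).E →+* ℂ)) =
          (arithmeticLevel (↥(maximalRealSubfield L)) L (IsCMField.complexConj L) 3 H
            (K.1.1.map (MulAut.conj (g q)).toMonoidHom)).map (Matrix.GeneralLinearGroup.map τ) ∧
        ∀ x : Ball, AlgPoints.map (ι q) ((B q).unif ((T : Matrix (Fin 3) (Fin 3) ℂ) *ᵥ BallModel.lift x)) =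
          AlgPoints.baseChangeEquiv τ (S.M.obj K) ((S.pts K).symm (ShimuraSet.mk L H τ T hT K.1.1 x (g q))) :=
  Record.exists_pieces L H τ T hT K.1.1 hH hanis hpos K.1.2.2 K.1.2.1
    (torsionFree_arithmeticLevel_conj_of_le K.2 htf)
    (S.record L H τ T hT K)

end Summit.HodgeConjecture.CorCM.HComp

end
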